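import Summits.ValiantsHypothesis.ValiantsHypothesis.Theorems.MonotoneRestorationOrbitCompressionQPNarrowToOrbit
import HarnessLib

/-!
# Route MonotoneRestoration — aside `OrbitCompressionQP` (stmt-ValiantsHypothesis-18332), line
# `expression_compression`: consequences of "narrow expressions have quasi-polynomial orbits"

Sequel of `…OrbitCompressionQPNarrowToOrbit.lean` (`NarrowToOrbit.qpOrbit_of_narrowExpression`: the
conclusion of `stub_orbitToNarrowExpression` implies its circuit hypothesis, for expressions of any length).

* `narrow_iff_qpOrbit_of_repairedStub` — if the REPAIRED first stub holds (matrix symmetry of `f` added to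
  the registered form, which is refuted: `OrbitToNarrowExpression.not_stub_orbitToNarrowExpression`), then
  "narrow closed expressions (polylog labels, any length)" and "square-symmetric circuits of quasi-polynomial
  ORBIT size" are EQUIVALENT presentations of a matrix-symmetric family: the line cuts the aside exactly at
  its own hypothesis, re-expressed in the pattern-expression currency;
* `circuitCompression_of_orbitCompressionQP` — the CIRCUIT FORM of Stub 2 ("matrix-symmetric `VP` families
  with narrow expressions have square-symmetric circuits of quasi-polynomial SIZE") follows from the aside;
* `circuitCompression_of_stub_narrowExpressionCompression` — and from Stub 2 (verbatim, as a hypothesis)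
  through THEOREM ζ-P `qpSymmetric_patternExpr`: the circuit form is sandwiched between the aside and its
  registered second stub.

Helper file (`--supports stmt-ValiantsHypothesis-18332`); def-free; nothing here is a named fact; the aside
and both stubs stay open.
-/

noncomputable section

-- `Summit.ValiantsHypothesis.ValiantsHypothesis.…` is the tree's single-conjunct layout (Sub = Summit).
set_option linter.dupNamespace false

namespace Summit.ValiantsHypothesis.ValiantsHypothesis.Theorems

namespace NarrowToOrbit

open Literature.Computability.AlgebraicComplexity MvPolynomial

/-! ### Consequences for the line -/

/-- **If the REPAIRED Stub 1 holds** (matrix symmetry of `f` added to the registered, refuted form), **then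
"narrow closed expressions" and "square-symmetric circuits of quasi-polynomial orbit size" are EQUIVALENT
presentations of a matrix-symmetric family** — the line's cut point is the aside's hypothesis in the
pattern-expression currency. [folklore] -/
theorem narrow_iff_qpOrbit_of_repairedStub
    (hS1 : ∀ f : (n : ℕ) → MvPolynomial (Fin n × Fin n) ℂ,
      (∀ (n : ℕ) (σ τ : Equiv.Perm (Fin n)),
        MvPolynomial.rename (fun p : Fin n × Fin n => (σ p.1, τ p.2)) (f n) = f n) →
      (∃ c : ℕ, ∀ n : ℕ, ∃ (G : Type) (_ : Fintype G)
          (C : LabelledArithCircuit ℂ (Fin n × Fin n) Unit G),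
        C.IsSymmetric (Equiv.Perm (Fin n)) ∧ C.eval (C.output ()) = f n ∧
        C.orbitSize (Equiv.Perm (Fin n)) ≤ 2 ^ ((Nat.log 2 n + c) ^ c)) →
      ∃ c : ℕ, ∀ n : ℕ, 1 ≤ n → ∃ (k l : ℕ) (e : PatternExpr ℂ k l),
        n ^ (k + l) ≤ 2 ^ ((Nat.log 2 n + c) ^ c) ∧ e.close n = f n)
    (f : (n : ℕ) → MvPolynomial (Fin n × Fin n) ℂ)
    (hsymm : ∀ (n : ℕ) (σ τ : Equiv.Perm (Fin n)),
      MvPolynomial.rename (fun p : Fin n × Fin n => (σ p.1, τ p.2)) (f n) = f n) :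
    (∃ c : ℕ, ∀ n : ℕ, 1 ≤ n → ∃ (k l : ℕ) (e : PatternExpr ℂ k l),
        n ^ (k + l) ≤ 2 ^ ((Nat.log 2 n + c) ^ c) ∧ e.close n = f n) ↔
    (∃ c : ℕ, ∀ n : ℕ, ∃ (G : Type) (_ : Fintype G)
        (C : LabelledArithCircuit ℂ (Fin n × Fin n) Unit G),
      C.IsSymmetric (Equiv.Perm (Fin n)) ∧ C.eval (C.output ()) = f n ∧
      C.orbitSize (Equiv.Perm (Fin n)) ≤ 2 ^ ((Nat.log 2 n + c) ^ c)) :=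
  ⟨qpOrbit_of_narrowExpression' f, hS1 f hsymm⟩

/-- **THE CIRCUIT FORM OF STUB 2 FOLLOWS FROM THE ASIDE.**  If `OrbitCompressionQP` holds, then every
matrix-symmetric `VP` family presented by narrow closed expressions (polylog labels, ANY length) has
square-symmetric circuits of quasi-polynomial SIZE — because narrow expressions already give
quasi-polynomial ORBITS (`qpOrbit_of_narrowExpression`). [folklore] -/
theorem circuitCompression_of_orbitCompressionQP (h : Theses.MonotoneRestoration.OrbitCompressionQP) :
    ∀ f : (n : ℕ) → MvPolynomial (Fin n × Fin n) ℂ,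
      (∀ (n : ℕ) (σ τ : Equiv.Perm (Fin n)),
        MvPolynomial.rename (fun p : Fin n × Fin n => (σ p.1, τ p.2)) (f n) = f n) →
      IsVPFamily f →
      (∃ c : ℕ, ∀ n : ℕ, 1 ≤ n → ∃ (k l : ℕ) (e : PatternExpr ℂ k l),
        n ^ (k + l) ≤ 2 ^ ((Nat.log 2 n + c) ^ c) ∧ e.close n = f n) →
      ∃ c : ℕ, ∀ n : ℕ, ∃ (G : Type) (_ : Fintype G)
        (C : LabelledArithCircuit ℂ (Fin n × Fin n) Unit G),
        C.IsSymmetric (Equiv.Perm (Fin n)) ∧ C.eval (C.output ()) = f n ∧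
          Fintype.card G ≤ 2 ^ ((Nat.log 2 n + c) ^ c) :=
  fun f hsymm hVP hnarrow => h f hsymm hVP (qpOrbit_of_narrowExpression' f hnarrow)

/-- **The circuit form of Stub 2 follows from Stub 2** (verbatim the registered signature, taken as a
hypothesis) through THEOREM ζ-P `qpSymmetric_patternExpr`.  With the previous theorem: the circuit form
is sandwiched between the aside and its registered second stub. [folklore] -/
theorem circuitCompression_of_stub_narrowExpressionCompression
    (h2 : ∀ f : (n : ℕ) → MvPolynomial (Fin n × Fin n) ℂ,
      (∀ (n : ℕ) (σ τ : Equiv.Perm (Fin n)),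
        MvPolynomial.rename (fun p : Fin n × Fin n => (σ p.1, τ p.2)) (f n) = f n) →
      IsVPFamily f →
      (∃ c : ℕ, ∀ n : ℕ, 1 ≤ n → ∃ (k l : ℕ) (e : PatternExpr ℂ k l),
        n ^ (k + l) ≤ 2 ^ ((Nat.log 2 n + c) ^ c) ∧ e.close n = f n) →
      ∃ c : ℕ, ∀ n : ℕ, 1 ≤ n → ∃ (k l : ℕ) (e : PatternExpr ℂ k l),
        n ^ (k + l) ≤ 2 ^ ((Nat.log 2 n + c) ^ c) ∧ e.length ≤ 2 ^ ((Nat.log 2 n + c) ^ c) ∧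
        e.close n = f n) :
    ∀ f : (n : ℕ) → MvPolynomial (Fin n × Fin n) ℂ,
      (∀ (n : ℕ) (σ τ : Equiv.Perm (Fin n)),
        MvPolynomial.rename (fun p : Fin n × Fin n => (σ p.1, τ p.2)) (f n) = f n) →
      IsVPFamily f →
      (∃ c : ℕ, ∀ n : ℕ, 1 ≤ n → ∃ (k l : ℕ) (e : PatternExpr ℂ k l),
        n ^ (k + l) ≤ 2 ^ ((Nat.log 2 n + c) ^ c) ∧ e.close n = f n) →
      ∃ c : ℕ, ∀ n : ℕ, ∃ (G : Type) (_ : Fintype G)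
        (C : LabelledArithCircuit ℂ (Fin n × Fin n) Unit G),
        C.IsSymmetric (Equiv.Perm (Fin n)) ∧ C.eval (C.output ()) = f n ∧
          Fintype.card G ≤ 2 ^ ((Nat.log 2 n + c) ^ c) :=
  fun f hsymm hVP hnarrow => qpSymmetric_patternExpr f (h2 f hsymm hVP hnarrow)

end NarrowToOrbit

end Summit.ValiantsHypothesis.ValiantsHypothesis.Theorems

end
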